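import Summits.HodgeConjecture.CorCM.MumfordTateRankFour
import Literature.AlgebraicGeometry.Motives.HodgeLieWeightOneRankFourRange
import HarnessLib

/-!
# The rung `dim Hg(H¹(X)) = 4` of the Mumford–Tate rank ladder for complex abelian varieties NOT of CM type, I:
# the central element `z ∈ End⁰(X)` with `z³ = qz`

COR-CM (cell `pub-hodgecm2`, seat `b27` gen 33, count-neutral lane MT-RANK-FIVE; theorems only, no definition, no
named fact; UNCONDITIONAL — nothing here uses or asserts HC_CM).  Sequel of `CorCM/MumfordTateRankFour` (gen 30:
`dim MT(H¹X) ≤ 4`, i.e. `dim Hg(H¹X) = 3`, for non-CM `X`).  Here the next value: `X` a complex abelian variety NOT of CM type with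
`dim_ℚ Lie Hg(H¹(X)) = 4` (which holds when `dim MT(H¹X) = 5`, `MT = 𝔾ₘ · Hg`; the tree records
`dim Hg + 1 ≤ dim MT`, so `dim MT(H¹X) ≤ 5` gives `dim Lie Hg ∈ {3, 4}` for non-CM `X`).

The abstract structure theorem `HodgeStructure.exists_rat_central_of_finrank_hodgeLie_eq_four`
(`Motives/HodgeLieWeightOneRankFour{Blocks,Basis,Center,Splitting,Cube,Corner,Range}`: the Hodge Lie algebra is
`𝔰𝔩₂ ⊕ ℚφ` with `φ` a rational central Hodge endomorphism, `φ³ = qφ`, `q < 0`, the `𝔰𝔩₂`-part killing `range φ`)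
is transported to `End⁰(X)` through the rational representation (Riemann: `bettiRep` is injective with image
`End_Hdg(H¹X)`, `exists_hom_bettiMap_eq_smul_of_mem_endAlg`):

* **`exists_center_cube_of_finrank_hodgeLie_eq_four`** — there are `z` in the CENTRE of `End⁰(X)` and `q ∈ ℚ_{<0}`
  with `z ≠ 0`, `z³ = q z`, `z` NOT a unit, such that, with `e' = 1 − q⁻¹z²` (the central idempotent cutting out the
  «`𝔰𝔩₂`-part»): every element of the corner `{w | z w = 0}` commuting with that corner is a rational multiple of `e'`;
  and there are natural numbers `x, y` (the dimensions of `ker z^*`, `range z^*` on `H¹(X(ℂ); ℚ)`) with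
  `x + y = 2 dim X`, `0 < x`, `0 < y`, `x² = 4 · dim_ℚ {w | z w = 0}`, `y² = 2 · dim_ℚ {w | q w = z² w}`.
* `exists_isIsogenous_power_of_finrank_hodgeLie_le_three` — the previous rung (`CorCM/MumfordTateRankFour`, filed under
  `dim MT(H¹X) ≤ 4`) restated under `dim_ℚ Lie Hg(H¹X) ≤ 3`: `X ∼ B^{m+1}`, `B` simple, not of CM type, `Z(End⁰ B) = ℚ`,
  `dim End⁰(B) = (dim B)²` — so that the sequel can state the dichotomy for `dim MT(H¹X) ≤ 5`.

The sequel `CorCM/MumfordTateRankFive` reads these off the isotypic decomposition: `X ∼ B^{a} × E^{b}` with `E` an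
elliptic curve with complex multiplication by `ℚ(√q)` and `B` simple, not of CM type, `dim End⁰(B) = (dim B)²`; §0
collects the elementary arithmetic (`x² = 2m² ⇒ m = 0`, Cauchy–Schwarz-type sum inequalities with their equality
cases) and the one piece of linear algebra (complementary subspaces of a `ℚ`-algebra have complementary dimensions,
stated for a general `ℚ`-algebra to keep clear of the two module-structure paths on `End⁰(X)`) used there.

## References

* [MoonenZarhin1999LowDim] B. Moonen, Yu. Zarhin, *Hodge classes on abelian varieties of low dimension*, Math. Ann.
  315 (1999), §2 (`MT = 𝔾ₘ·Hg`, `End⁰(X) = End_{Hg}(H¹)`, (2.3)–(2.5)).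
* [DeligneMilne1982Tannakian] P. Deligne, J. S. Milne, *Tannakian Categories*, LNM 900 (1982), II Thm. 6.20 (Riemann).
* [MumfordAV1970] D. Mumford, *Abelian Varieties* (1970), §19 (the rational representation; Thm. 3 and Cor.).
-/

noncomputable section

open scoped TensorProduct
open CategoryTheory CategoryTheory.Limits Module

namespace Summit.HodgeConjecture.CorCM

open Literature.AlgebraicGeometry.Motives
open Literature.AlgebraicGeometry.Motives.AbelianVariety
open Literature.AlgebraicGeometry.Motives.HodgeStructure
open Literature.AlgebraicGeometry.HodgeTheory
open Literature.AlgebraicGeometry.ComplexMultiplication (bettiRep bettiRep_injective bettiRep_of unop_bettiRep_mem_endAlg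
  nontrivial_endAlgebra_of_dim_pos)
open Literature.AlgebraicGeometry.Milne1999 (IsOfCMType isOfCMType_iff_of_isIsogenous)

/-! ## §0 Elementary arithmetic and linear algebra used in the sequel `CorCM/MumfordTateRankFive` -/

/-- `x² = 2 m²` in natural numbers forces `m = 0` (`√2` is irrational; infinite descent). [folklore] -/
theorem eq_zero_of_sq_eq_two_mul_sq : ∀ (m x : ℕ), x ^ 2 = 2 * m ^ 2 → m = 0 := by
  intro m
  induction m using Nat.strong_induction_on with
  | _ m ih =>
    intro x hx
    by_contra hm
    have hx2 : 2 ∣ x := by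
      have h : 2 ∣ x ^ 2 := ⟨m ^ 2, hx⟩
      exact (Nat.Prime.dvd_of_dvd_pow Nat.prime_two h)
    obtain ⟨a, rfl⟩ := hx2
    have hm2 : m ^ 2 = 2 * a ^ 2 := by nlinarith
    have hm2' : 2 ∣ m := Nat.Prime.dvd_of_dvd_pow Nat.prime_two ⟨a ^ 2, hm2⟩
    obtain ⟨c, rfl⟩ := hm2'
    have ha2 : a ^ 2 = 2 * c ^ 2 := by nlinarith
    have hc : c = 0 := ih c (by omega) a ha2
    exact hm (by rw [hc, mul_zero])

/-- For natural numbers with `d ≤ 2 g`, `0 < m`, `0 < g` and `x² = 4 m² d`: `x ≤ 2 m g`, with equality only if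
`d = g²` (and `d = 2`, `g = 1` is impossible: `x² = 8m²`). [folklore] -/
theorem le_of_sq_eq_four_mul_sq_mul {x m d g : ℕ} (hm : 0 < m) (hg : 0 < g) (hd : d ≤ 2 * g)
    (hx : x ^ 2 = 4 * (m ^ 2 * d)) : x ≤ 2 * m * g ∧ (x = 2 * m * g → d = g ^ 2) := by
  constructor
  · by_contra hlt
    push Not at hlt
    have h1 : (2 * m * g) ^ 2 < x ^ 2 := Nat.pow_lt_pow_left hlt two_ne_zero
    rw [hx] at h1
    -- `4 m² g² < 4 m² d ≤ 8 m² g`, so `g < 2`, `g = 1`, `d = 2`, `x² = 8 m²`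
    have h2 : g ^ 2 < d := by nlinarith
    have hg1 : g = 1 := by nlinarith
    subst hg1
    have hd2 : d = 2 := by omega
    subst hd2
    have h := eq_zero_of_sq_eq_two_mul_sq (2 * m) x (by rw [hx]; ring)
    omega
  · intro h
    subst h
    have h' : 4 * (m ^ 2 * d) = 4 * (m ^ 2 * g ^ 2) := by rw [← hx]; ring
    have hm2 : 0 < m ^ 2 := pow_pos hm 2
    have := Nat.eq_of_mul_eq_mul_left (by norm_num : 0 < 4) h'
    exact Nat.eq_of_mul_eq_mul_left hm2 this

/-- `Σ a² ≤ (Σ a)²` for natural numbers. [folklore] -/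
theorem sum_sq_le_sq_sum {ι : Type*} (s : Finset ι) (a : ι → ℕ) : ∑ l ∈ s, a l ^ 2 ≤ (∑ l ∈ s, a l) ^ 2 := by
  classical
  induction s using Finset.induction_on with
  | empty => simp
  | insert x t hx ih =>
    rw [Finset.sum_insert hx, Finset.sum_insert hx]
    nlinarith [Nat.zero_le (a x * ∑ l ∈ t, a l)]

/-- If `(Σ a)² = Σ a²` with all `a l > 0` then the index set has at most one element. [folklore] -/
theorem eq_of_sq_sum_eq_sum_sq {ι : Type*} [DecidableEq ι] (s : Finset ι) (a : ι → ℕ) (hpos : ∀ l ∈ s, 0 < a l)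
    (h : (∑ l ∈ s, a l) ^ 2 = ∑ l ∈ s, a l ^ 2) {j l : ι} (hj : j ∈ s) (hl : l ∈ s) : l = j := by
  by_contra hlj
  have hl' : l ∈ s.erase j := Finset.mem_erase.2 ⟨hlj, hl⟩
  have hsum : ∑ k ∈ s, a k = a j + ∑ k ∈ s.erase j, a k := (Finset.add_sum_erase s a hj).symm
  have hsum2 : ∑ k ∈ s, a k ^ 2 = a j ^ 2 + ∑ k ∈ s.erase j, a k ^ 2 := (Finset.add_sum_erase s (fun k => a k ^ 2) hj).symm
  have hle := sum_sq_le_sq_sum (s.erase j) a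
  have hpos' : 0 < ∑ k ∈ s.erase j, a k := Finset.sum_pos' (fun k _ => Nat.zero_le _) ⟨l, hl', hpos l hl⟩
  have hjpos := hpos j hj
  rw [hsum, hsum2] at h
  nlinarith

/-- Complementary subspaces of a finite-dimensional `ℚ`-algebra have complementary dimensions (stated for a general
`ℚ`-algebra `R`, whose module structure comes from the algebra structure). [folklore] -/
theorem finrank_add_finrank_of_isCompl {R : Type*} [Ring R] [Algebra ℚ R] [Module.Finite ℚ R] (K₁ K₂ : Submodule ℚ R)
    (hinf : K₁ ⊓ K₂ = ⊥) (hsup : K₁ ⊔ K₂ = ⊤) :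
    Module.finrank ℚ K₁ + Module.finrank ℚ K₂ = Module.finrank ℚ R := by
  have h := Submodule.finrank_sup_add_finrank_inf_eq K₁ K₂
  rw [hinf, hsup, finrank_bot, finrank_top, add_zero] at h
  exact h.symm

variable [HodgeTensorFacts.{0, 0}] {X : AbelianVariety ℂ} {n : ℕ}

/-! ## §1 The rational representation maps `End⁰(X)` onto `End_Hdg(H¹(X))` -/

omit [HodgeTensorFacts.{0, 0}] in
/-- **Every Hodge endomorphism of `H¹(X(ℂ); ℚ)` is `w^*` for a unique `w ∈ End⁰(X)`** (Riemann, Deligne–Milne Thm. 6.20: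
`u^* = k • a` with `k ≥ 1`; take `w = k⁻¹ u`). [cite: DeligneMilne1982Tannakian, II §6 Thm. 6.20]
[cite: MumfordAV1970, §19 Thm. 3] -/
theorem exists_unop_bettiRep_eq_of_mem_endAlg (hX : IsSmoothProjective n X.X) {a : Module.End ℚ (bettiCohomology X.X 1)}
    (ha : a ∈ (BettiUniverse.hodge exists_isReal_hodgeModel_holds hX 1).endAlg) :
    ∃ w : X.endAlgebra, MulOpposite.unop (bettiRep X w) = a := by
  obtain ⟨u, k, hk, hu⟩ := exists_hom_bettiMap_eq_smul_of_mem_endAlg hX ha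
  refine ⟨algebraMap ℚ X.endAlgebra ((k : ℚ)⁻¹) * AbelianVariety.endAlgebra.of X (End.of u), ?_⟩
  rw [map_mul, AlgHom.commutes, bettiRep_of, Algebra.algebraMap_eq_smul_one, smul_mul_assoc, one_mul,
    MulOpposite.unop_smul, MulOpposite.unop_op]
  change (k : ℚ)⁻¹ • (bettiCohomology.map u.hom.hom.hom 1).hom = a
  rw [hu, smul_smul, inv_mul_cancel₀ (by exact_mod_cast hk.ne'), one_smul]

/-! ## §2 The central element `z` with `z³ = qz` -/

/-- **The central element of `End⁰(X)` for a non-CM abelian variety with `dim Hg(H¹X) = 4`.**  For `X` a complex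
abelian variety, not of CM type, with `dim_ℚ Lie Hg(H¹(X)) = 4`, there are `z ∈ Z(End⁰(X))` and
`q ∈ ℚ`, `q < 0`, with `z ≠ 0`, `z³ = q z`, `z` not a unit; every `w` with `z w = 0` commuting with all such `w'` is
`c · (1 − q⁻¹ z²)` (`c ∈ ℚ`); and natural numbers `x, y` with `x + y = 2 dim X`, `0 < x`, `0 < y`,
`x² = 4 dim_ℚ {w | z w = 0}`, `y² = 2 dim_ℚ {w | q w = z² w}` (`x = dim ker z^*`, `y = dim range z^*` on `H¹(X(ℂ); ℚ)`;
the two subspaces are given through their membership predicates).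
Transport of `HodgeStructure.exists_rat_central_of_finrank_hodgeLie_eq_four` along the rational representation
(`bettiRep`, injective onto `End_Hdg`, an anti-homomorphism — harmless since `z` is central).
[cite: MoonenZarhin1999LowDim, §2] [cite: DeligneMilne1982Tannakian, II §6 Thm. 6.20] [cite: MumfordAV1970, §19 Thm. 3] -/
theorem exists_center_cube_of_finrank_hodgeLie_eq_four (hX : IsSmoothProjective n X.X) (hcm : ¬ IsOfCMType X)
    (h4 : haveI := BettiUniverse.finite hX 1
      Module.finrank ℚ (BettiUniverse.hodge exists_isReal_hodgeModel_holds hX 1).hodgeLie = 4) :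
    ∃ (z : X.endAlgebra) (q : ℚ), z ∈ Subalgebra.center ℚ X.endAlgebra ∧ q < 0 ∧ z ≠ 0 ∧ z * z * z = q • z ∧
      ¬ IsUnit z ∧
      (∀ w : X.endAlgebra, z * w = 0 → (∀ w' : X.endAlgebra, z * w' = 0 → w * w' = w' * w) →
        ∃ c : ℚ, w = c • (1 - q⁻¹ • (z * z))) ∧
      ∃ x y : ℕ, x + y = 2 * X.dim ∧ 0 < x ∧ 0 < y ∧
        (∀ K : Submodule ℚ X.endAlgebra, (∀ w, w ∈ K ↔ z * w = 0) → x ^ 2 = 4 * Module.finrank ℚ K) ∧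
        (∀ K : Submodule ℚ X.endAlgebra, (∀ w, w ∈ K ↔ q • w = z * z * w) → y ^ 2 = 2 * Module.finrank ℚ K) := by
  have hn : X.dim = n := schemeDim_eq_holds hX
  subst hn
  haveI := BettiUniverse.finite hX 1
  haveI : Module.Finite ℚ X.endAlgebra := finiteDimensional_endAlgebra_holds X
  set V := bettiCohomology X.X 1
  set H := BettiUniverse.hodge exists_isReal_hodgeModel_holds hX 1 with hH
  obtain ⟨ψ⟩ := BettiUniverse.hodge_isPolarizable exists_isReal_hodgeModel_holds hX 1
  have hne : ¬ H.hodgeLie ≤ Subalgebra.toSubmodule H.endAlg := fun h =>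
    hcm ((isOfCMType_iff_mumfordTateLieAlgebra_le_endAlg hX).2 ((hodgeLie_le_endAlg_iff H).1 h))
  obtain ⟨φ, q, -, hφ0, hφA, hφcA, hq, hq3, hker, hdim, hcen, -, hdim''⟩ :=
    exists_rat_central_of_finrank_hodgeLie_eq_four H ψ (by simp) (BettiUniverse.hodge_isEffective _ hX 1) hne h4
  -- the rational representation `ρ : w ↦ w^*`
  let ρ : X.endAlgebra →ₗ[ℚ] Module.End ℚ V :=
    (MulOpposite.opLinearEquiv ℚ (M := Module.End ℚ V)).symm.toLinearMap ∘ₗ (bettiRep X).toLinearMap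
  have hρ : ∀ w, ρ w = MulOpposite.unop (bettiRep X w) := fun w => rfl
  have hρinj : Function.Injective ρ := fun w w' h => by
    rw [hρ, hρ] at h
    exact bettiRep_injective (MulOpposite.unop_injective h)
  have hρA : ∀ w, ρ w ∈ H.endAlg := fun w =>
    unop_bettiRep_mem_endAlg exists_isReal_hodgeModel_holds hodgePQ_independent_of_hodgeModel_holds w
  have hρmul : ∀ w w', ρ (w * w') = ρ w' * ρ w := fun w w' => by rw [hρ, hρ, hρ, map_mul, MulOpposite.unop_mul]
  -- the central element
  obtain ⟨z, hz⟩ := exists_unop_bettiRep_eq_of_mem_endAlg hX hφA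
  have hρz : ρ z = φ := hz
  have hzφ : ∀ w, ρ (z * w) = φ * ρ w := fun w => by rw [hρmul, hρz, hφcA _ (hρA w)]
  have hzφ' : ∀ w, ρ (w * z) = φ * ρ w := fun w => by rw [hρmul, hρz]
  have hzc : z ∈ Subalgebra.center ℚ X.endAlgebra := by
    rw [Subalgebra.mem_center_iff]
    intro w
    exact hρinj (by rw [hzφ', hzφ])
  have hz0 : z ≠ 0 := fun h => hφ0 (by rw [← hρz, h, map_zero])
  have hz3 : z * z * z = q • z := hρinj (by rw [hρmul, hρmul, hρz, map_smul, hρz, ← mul_assoc, hq3])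
  have hzu : ¬ IsUnit z := by
    rintro ⟨u, hu⟩
    apply hker
    rw [LinearMap.ker_eq_bot']
    intro v hv
    have h : ρ (↑u⁻¹ * z) v = v := by rw [← hu, Units.inv_mul, hρ, map_one, MulOpposite.unop_one, Module.End.one_apply]
    rw [hzφ', hφcA _ (hρA _), Module.End.mul_apply, hv, map_zero] at h
    exact h.symm
  -- the two corners, transported
  have hfin' : ∀ K : Submodule ℚ X.endAlgebra, (∀ w, w ∈ K ↔ z * w = 0) →
      Module.finrank ℚ K = Module.finrank ℚ ↥(Subalgebra.toSubmodule H.endAlg ⊓ LinearMap.ker (LinearMap.mulRight ℚ φ)) := by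
    intro K hK
    have hmap : K.map ρ = Subalgebra.toSubmodule H.endAlg ⊓ LinearMap.ker (LinearMap.mulRight ℚ φ) := by
      ext a
      simp only [Submodule.mem_map, Submodule.mem_inf, Subalgebra.mem_toSubmodule, LinearMap.mem_ker,
        LinearMap.mulRight_apply]
      constructor
      · rintro ⟨w, hw, rfl⟩
        refine ⟨hρA w, ?_⟩
        rw [← hφcA _ (hρA w), ← hzφ, (hK w).1 hw, map_zero]
      · rintro ⟨ha, haφ⟩
        obtain ⟨w, hw⟩ := exists_unop_bettiRep_eq_of_mem_endAlg hX ha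
        have hρw : ρ w = a := hw
        refine ⟨w, (hK w).2 (hρinj ?_), hρw⟩
        rw [hzφ, map_zero, hφcA _ (hρA w), hρw, haφ]
    rw [← hmap, ← (Submodule.equivMapOfInjective ρ hρinj _).finrank_eq]
  have hfin'' : ∀ K : Submodule ℚ X.endAlgebra, (∀ w, w ∈ K ↔ q • w = z * z * w) →
      Module.finrank ℚ K = Module.finrank ℚ ↥(Subalgebra.toSubmodule H.endAlg ⊓
        LinearMap.ker (LinearMap.mulRight ℚ (φ * φ) - q • LinearMap.id)) := by
    intro K hK
    have hzz : ∀ w, ρ (z * z * w) = ρ w * (φ * φ) := fun w => by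
      have hc := hφcA _ (hρA w)
      rw [mul_assoc, hzφ, hzφ, ← mul_assoc, mul_assoc, hc, ← mul_assoc, hc, mul_assoc]
    have hmap : K.map ρ = Subalgebra.toSubmodule H.endAlg ⊓
        LinearMap.ker (LinearMap.mulRight ℚ (φ * φ) - q • LinearMap.id) := by
      ext a
      simp only [Submodule.mem_map, Submodule.mem_inf, Subalgebra.mem_toSubmodule, LinearMap.mem_ker, LinearMap.sub_apply,
        LinearMap.mulRight_apply, LinearMap.smul_apply, LinearMap.id_coe, id_eq, sub_eq_zero]
      constructor
      · rintro ⟨w, hw, rfl⟩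
        exact ⟨hρA w, by rw [← hzz, ← (hK w).1 hw, map_smul]⟩
      · rintro ⟨ha, haq⟩
        obtain ⟨w, hw⟩ := exists_unop_bettiRep_eq_of_mem_endAlg hX ha
        have hρw : ρ w = a := hw
        refine ⟨w, (hK w).2 (hρinj ?_), hρw⟩
        rw [hzz, map_smul, hρw, haq]
    rw [← hmap, ← (Submodule.equivMapOfInjective ρ hρinj _).finrank_eq]
  -- the centre of the corner, transported
  have hcen' : ∀ w : X.endAlgebra, z * w = 0 → (∀ w' : X.endAlgebra, z * w' = 0 → w * w' = w' * w) →
      ∃ c : ℚ, w = c • (1 - q⁻¹ • (z * z)) := by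
    intro w hw hwc
    have hwφ : ρ w * φ = 0 := by rw [← hφcA _ (hρA w), ← hzφ, hw, map_zero]
    obtain ⟨c, hc⟩ := hcen (ρ w) (hρA w) hwφ (fun a ha haφ => by
      obtain ⟨w', hw'⟩ := exists_unop_bettiRep_eq_of_mem_endAlg hX ha
      have hρw' : ρ w' = a := hw'
      have hzw' : z * w' = 0 := hρinj (by rw [hzφ, map_zero, hφcA _ (hρA w'), hρw', haφ])
      rw [← hρw', ← hρmul, ← hρmul, hwc w' hzw'])
    refine ⟨c, hρinj ?_⟩
    rw [hc, map_smul, map_sub, map_smul, hρmul, hρz, hρ (1 : X.endAlgebra), map_one, MulOpposite.unop_one]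
  -- the dimensions
  have hsum := LinearMap.finrank_range_add_finrank_ker φ
  rw [finrank_bettiCohomology_one] at hsum
  refine ⟨z, q, hzc, hq, hz0, hz3, hzu, hcen', Module.finrank ℚ (LinearMap.ker φ), Module.finrank ℚ (LinearMap.range φ),
    by omega, ?_, ?_, fun K hK => ?_, fun K hK => ?_⟩
  · exact Nat.pos_of_ne_zero fun h => hker (Submodule.finrank_eq_zero.1 h)
  · refine Nat.pos_of_ne_zero fun h => hφ0 ?_
    have h' : LinearMap.range φ = ⊥ := Submodule.finrank_eq_zero.1 h
    exact LinearMap.range_eq_bot.1 h'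
  · rw [hfin' K hK, hdim]
  · rw [hfin'' K hK, hdim'']

/-! ## §3 The previous rung `dim Hg(H¹(X)) ≤ 3` under the Hodge-group hypothesis -/

/-- **`X` not of CM type with `dim_ℚ Lie Hg(H¹X) ≤ 3` ⟹ `X ∼ B^{m+1}`** with `B` simple, not of CM type,
`Z(End⁰ B) = ℚ`, `dim X = (m+1) dim B`, `dim_ℚ End⁰(B) = (dim B)²`: the statement of `CorCM/MumfordTateRankFour`
(`exists_isIsogenous_power_of_not_isOfCMType`, filed under `dim MT(H¹X) ≤ 4`) under the hypothesis on the Hodge group in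
which `Motives/HodgeLieWeightOneRankThree` is stated (`Z(End_Hdg) = ℚ` transported by `mem_bot_of_mem_center_endAlgebra`,
`4 dim End_Hdg = (2 dim X)²`, isotypicity from `Z(End⁰ X) = ℚ`). [cite: MoonenZarhin1999LowDim, §2]
[cite: MumfordAV1970, §19 Thm. 1 Cor. 1 and p. 174] -/
theorem exists_isIsogenous_power_of_finrank_hodgeLie_le_three (hX : IsSmoothProjective n X.X) (h0 : 0 < X.dim)
    (hcm : ¬ IsOfCMType X)
    (h3 : haveI := BettiUniverse.finite hX 1
      Module.finrank ℚ (BettiUniverse.hodge exists_isReal_hodgeModel_holds hX 1).hodgeLie ≤ 3) :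
    ∃ (B : AbelianVariety ℂ) (m : ℕ), B.IsSimple ∧ 0 < B.dim ∧ ¬ IsOfCMType B ∧
      IsIsogenous X (⨁ fun _ : Fin (m + 1) => B) ∧ X.dim = (m + 1) * B.dim ∧
      Module.finrank ℚ B.endAlgebra = B.dim ^ 2 ∧ Module.finrank ℚ (Subalgebra.center ℚ B.endAlgebra) = 1 := by
  have hn : X.dim = n := schemeDim_eq_holds hX
  subst hn
  haveI := BettiUniverse.finite hX 1
  haveI := nontrivial_bettiCohomology_one h0
  set H := BettiUniverse.hodge exists_isReal_hodgeModel_holds hX 1 with hH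
  obtain ⟨ψ⟩ := BettiUniverse.hodge_isPolarizable exists_isReal_hodgeModel_holds hX 1
  have hne : ¬ H.hodgeLie ≤ Subalgebra.toSubmodule H.endAlg := fun h =>
    hcm ((isOfCMType_iff_mumfordTateLieAlgebra_le_endAlg hX).2 ((hodgeLie_le_endAlg_iff H).1 h))
  -- the centre of `End⁰(X)` is `ℚ`
  have hbot : Subalgebra.center ℚ X.endAlgebra = ⊥ :=
    le_antisymm (fun w hw => mem_bot_of_mem_center_endAlgebra hX (fun z' hz' hzc =>
      exists_eq_smul_one_of_mem_center_endAlg H ψ (by simp) (BettiUniverse.hodge_isEffective _ hX 1) hne h3 hz' hzc) hw)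
      bot_le
  have hZ : Module.finrank ℚ (Subalgebra.center ℚ X.endAlgebra) = 1 := by
    haveI := nontrivial_endAlgebra_of_dim_pos (B := X) h0
    rw [hbot, Subalgebra.finrank_bot]
  obtain ⟨B, m, hS, hB, hXB, hdim, hfinB, hZB⟩ := exists_isIsogenous_power_of_finrank_center_eq_one hZ
  -- `dim End⁰(X) = (dim X)²`
  have hsq := four_mul_finrank_endAlg_eq_sq H ψ (by simp) (BettiUniverse.hodge_isEffective _ hX 1) hne h3
  rw [finrank_bettiCohomology_one, ← finrank_endAlgebra_eq_finrank_endAlg hX] at hsq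
  have hfin : Module.finrank ℚ X.endAlgebra = X.dim ^ 2 := by
    have h : 4 * Module.finrank ℚ X.endAlgebra = 4 * X.dim ^ 2 := by rw [hsq]; ring
    omega
  refine ⟨B, m, hS, hB, fun hBcm => hcm ?_, hXB, hdim, ?_, hZB⟩
  · rw [isOfCMType_iff_of_isIsogenous hXB, CMProductEnd.isOfCMType_biproduct_fin_iff]
    exact fun _ => hBcm
  · rw [hfin, hdim] at hfinB
    have h : (m + 1) ^ 2 * Module.finrank ℚ B.endAlgebra = (m + 1) ^ 2 * B.dim ^ 2 := by rw [← hfinB]; ring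
    exact Nat.eq_of_mul_eq_mul_left (by positivity) h

end Summit.HodgeConjecture.CorCM

end
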